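import Summits.Ventures.PercRepro.MSRMStarMixedBridge

/-!
# The mixed class of a residue instance: every element of `ū` is non-tightening, partnerless
members lie inside `u₀`, facets above `ū` are `r`-lifted

In the mixed class `MixedII r F (u.erase r)` of a residue instance `(F, u)`, (SING-t) at an element
`z ∈ ū = univ ∖ u` with a tight trace would give `{z} ∈ F` or `univ ∖ z ∈ F`: the first puts the
`r`-only singleton `{z}` into `F₀` (against monotonicity at `ū`), the second makes `S' ∖ z ⊇ u₀`
an `r`-lifted face — against `u₀ ∉ P`. So **every `z ∈ ū` is a non-tightening direction**
(`not_tight_proj_of_mem_compl`), Theorem (NT) applies at it with `{r} ∈ K_z` and `r ∈ R_z`, and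
a member avoiding `r` containing `z` is lifted to a member `∋ r` above it: **every partnerless
member avoids `ū`**, i.e. lies inside `u₀` (`partnerless_subset_erase`), and **every face
containing an element of `ū` — in particular every facet of `P` above `ū` — is `r`-lifted**
(`mem_partr_of_mem_compl`). These are the objects of the pair lemma (Addendum 62 suppl. 2).
-/

namespace PercRepro.MSTight

open Finset
open scoped FinsetFamily

variable {α : Type*} [DecidableEq α] [Fintype α]

section ResidueMixed

variable {F : Finset (Finset α)} {u : Finset α} {r : α}

/-- In the mixed class of a residue instance, every element of `ū` is a non-tightening direction:
(SING-t) at `z` would make `S' ∖ z ⊇ u₀` a face. -/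
theorem not_tight_proj_of_mem_compl (h : Residue F u) (hM : MixedII r F (u.erase r))
    (hru : r ∈ u) {z : α} (hz : z ∈ univ \ u) : ¬ Tight (proj z F) := by
  intro hT
  have hzu : z ∉ u := (mem_sdiff.1 hz).2
  have hzr : z ≠ r := fun e => hzu (e ▸ hru)
  have hzub : z ∈ ubar r (u.erase r) := by rw [ubar_erase_eq hru]; exact hz
  rcases sing_t_of_residue h hT with hz1 | hz2
  · -- `{z} ∈ F`: the `r`-only singleton would be a member
    have hz0 : ({z} : Finset α) ∈ part0 r F :=
      mem_part0.2 ⟨hz1, fun e => hzr (mem_singleton.1 e).symm⟩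
    exact hM.notMem_part0_of_subset_ubar (singleton_subset_iff.2 hzub) hz0
  · -- `univ ∖ z ∈ F`: its `r`-erase is a face containing `u₀`
    have hrz : r ∈ univ.erase z := mem_erase.2 ⟨hzr.symm, mem_univ r⟩
    have h1 : (univ.erase z).erase r ∈ proj r F := mem_proj.2 ⟨_, hz2, rfl⟩
    have h2 : u.erase r ⊆ (univ.erase z).erase r := by
      intro a ha
      rw [mem_erase] at ha ⊢
      exact ⟨ha.1, mem_erase.2 ⟨fun e => hzu (e ▸ ha.2), mem_univ a⟩⟩
    exact hM.u0_notMem_proj (mem_proj_of_subset hM.tightP hM.singleton_mem hM.sing h1 h2)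

/-- The non-tightening hypothesis of Theorem (NT) at `z ∈ ū`. -/
theorem nonTightening_of_mem_compl (h : Residue F u) (hM : MixedII r F (u.erase r))
    (hru : r ∈ u) {z : α} (hz : z ∈ univ \ u) :
    (diffsX z F ∩ diffsY z F).card = (partner z F).card := by
  have hnt := not_tight_proj_of_mem_compl h hM hru hz
  have h1 := card_diffs_eq_card_diffs_proj_add z F
  have h2 := card_eq_card_proj_add_card_partner z F
  have h3 := Finset.card_le_card_diffs (proj z F)
  have h4 := card_partner_le_card_edges_diffs z F
  have h5 := h.hexc
  unfold Tight at hnt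
  omega

/-- `{r}` is a partner member of `F` at every `z ∈ ū` (`{z}` is `r`-lifted). -/
theorem singleton_r_mem_partner_of_mem_compl (hM : MixedII r F (u.erase r)) (hru : r ∈ u)
    {z : α} (hz : z ∈ univ \ u) : ({r} : Finset α) ∈ partner z F := by
  have hzu : z ∉ u := (mem_sdiff.1 hz).2
  have hzr : z ≠ r := fun e => hzu (e ▸ hru)
  have hzub : z ∈ ubar r (u.erase r) := by rw [ubar_erase_eq hru]; exact hz
  have hz1 : ({z} : Finset α) ∈ partr r F :=
    hM.monotone.1 _ hM.ubar_mem_partr _ (hM.sing z hzr) (singleton_subset_iff.2 hzub)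
  refine mem_partner_iff.2 ⟨hM.singleton_mem, fun e => hzr (mem_singleton.1 e), ?_⟩
  rw [Finset.pair_comm]
  exact (mem_partr.1 hz1).2

/-- `r` lies in the addable part of the partner family at `z ∈ ū` (Theorem (NT) (2a) at `{r}`). -/
theorem r_mem_Rstar_partner_of_mem_compl (h : Residue F u) (hM : MixedII r F (u.erase r))
    (hru : r ∈ u) {z : α} (hz : z ∈ univ \ u) : r ∈ Rstar (partner z F) := by
  have hzu : z ∉ u := (mem_sdiff.1 hz).2
  have hzr : z ≠ r := fun e => hzu (e ▸ hru)
  have hε := nonTightening_of_mem_compl h hM hru hz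
  have hK : (partner z F).Nonempty := ⟨{r}, singleton_r_mem_partner_of_mem_compl hM hru hz⟩
  have hs : ({r} : Finset α) ∈ part0 z F :=
    mem_part0.2 ⟨hM.singleton_mem, fun e => hzr (mem_singleton.1 e)⟩
  have hmem := inter_Rstar_mem_partner hε hK hs
  by_contra hr
  rw [Finset.singleton_inter_of_notMem hr] at hmem
  exact hM.empty_notMem (mem_of_mem_partner hmem)

/-- **A member avoiding `r` that meets `ū` is a partner member**: Theorem (NT) (2b) at `z ∈ s ∩ ū`
lifts `s` to the member `s ∪ R_z ∋ r`, whose `r`-erase lies above `s`. -/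
theorem mem_partr_of_mem_compl (h : Residue F u) (hM : MixedII r F (u.erase r)) (hru : r ∈ u)
    {s : Finset α} (hs : s ∈ part0 r F) {z : α} (hz : z ∈ univ \ u) (hzs : z ∈ s) :
    s ∈ partr r F := by
  have hε := nonTightening_of_mem_compl h hM hru hz
  have hK : (partner z F).Nonempty := ⟨{r}, singleton_r_mem_partner_of_mem_compl hM hru hz⟩
  have hr := r_mem_Rstar_partner_of_mem_compl h hM hru hz
  have hB := RMStar.union_Rstar_mem (mem_part0.1 hs).1 hzs hε hK
  have h1 : (s ∪ Rstar (partner z F)).erase r ∈ partr r F :=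
    mem_partr.2 ⟨notMem_erase r _, by rw [insert_erase (mem_union_right _ hr)]; exact hB⟩
  have h2 : s ⊆ (s ∪ Rstar (partner z F)).erase r := by
    intro a ha
    exact mem_erase.2 ⟨fun har => (mem_part0.1 hs).2 (har ▸ ha), mem_union_left _ ha⟩
  exact hM.monotone.1 _ h1 s (RMStar.mem_proj_of_mem_part0 hs) h2

/-- **Partnerless members lie inside `u₀`.** -/
theorem partnerless_subset_erase (h : Residue F u) (hM : MixedII r F (u.erase r)) (hru : r ∈ u)
    {p : Finset α} (hp0 : p ∈ part0 r F) (hp1 : p ∉ partr r F) : p ⊆ u.erase r := by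
  intro a ha
  have har : a ≠ r := fun e => (mem_part0.1 hp0).2 (e ▸ ha)
  rw [mem_erase]
  refine ⟨har, ?_⟩
  by_contra hau
  exact hp1 (mem_partr_of_mem_compl h hM hru hp0 (mem_sdiff.2 ⟨mem_univ a, hau⟩) ha)

/-- **Every face meeting `ū` is `r`-lifted**; in particular every facet of `P` above `ū`. -/
theorem mem_partr_of_mem_proj_of_mem_compl (h : Residue F u) (hM : MixedII r F (u.erase r))
    (hru : r ∈ u) {e : Finset α} (he : e ∈ proj r F) {z : α} (hz : z ∈ univ \ u) (hze : z ∈ e) :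
    e ∈ partr r F := by
  rcases RMStar.part0_or_partr he with h0 | h1
  · exact mem_partr_of_mem_compl h hM hru h0 hz hze
  · exact h1

end ResidueMixed

end PercRepro.MSTight
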